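import Literature.NumberTheory.EllipticCurves.HeightDensityFullBSDOffSsRankZero
import HarnessLib

/-!
# Row (ii-3a) of `PERCENT-FULL.md` at the vendored prime range `p ≥ 3` (the `p = 3` variant asked in T-PF12 (b))

`HeightDensityFullBSDOffSsRankZero.lean` types row (ii-3a) of the `pub-bsdpct` cell's `PERCENT-FULL.md` with
`S_ss(E) = {2, 3} ∪ {additive p} ∪ {good supersingular p}`: `BSD(E,p)` at every prime `p ≥ 5` of good ordinary
or multiplicative reduction, for at least the analytic-rank-`0` proportion of curves. Its per-pair glue
`bsdp_rankZero_of_Skinner2016` is already stated at `3 ≤ p`, because the one `p`-adic input — C. Skinner,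
*Multiplicative reduction and the cyclotomic main conjecture for `GL₂`*, Pacific J. Math. 283 (2016) 171–200,
Thm. C — is PRINTED for "good ordinary or multiplicative reduction at a prime `p ≥ 3`" (p. 173; tree fact
`Skinner2016_padicValRat_bsd_rank_zero` transcribes that range), and the two density-one inputs are uniform in
`p`: (F1) Duke 1997 Thm. 1 gives surjective `ρ̄_{E,p}` at EVERY prime `p` off a density-zero set
(`heightDensityGE_forall_surj_of_duke`), and (F3) the kernel sieve gives two primes `ℓ₁ ≠ ℓ₂`, `ℓᵢ ≥ 5`, with
`ord_{ℓᵢ}(4A³ + 27B²) = 1` (`heightDensityGE_twoOrdOnePrimes_one`), at which `E[p]` is ramified for every `p`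
(`p ∤ 1`), one of them `≠ p` — in particular at `p = 3`.

This file records the variant with the SMALLER excepted set

  `S_ss³(E) := {2} ∪ {p : E additive at p} ∪ {p : E good supersingular at p}`,

i.e. `BSD(E,p)` at every prime `p ≥ 3` (not only `p ≥ 5`) of good ordinary or multiplicative reduction, for the
same proportion and on the same five named hypotheses (`hA0`, Duke, Skinner 2016 Thm. C, modularity,
Gross–Zagier–Kolyvagin). Nothing new is cited and no constant changes: in the height family `y² = x³ + Ax + B`
the curves that are good ordinary or multiplicative at `3` have `3`-adic density `3/88572` (the cell's audited
local density N2), so the extra content is `BSD(E,3)` on that thin set; the cell's certified row keeps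
`3 ∈ S_ss(E)` and this variant is filed only as the typed form of the T-PF12 (b) question. PROVED here (no
`sorry`, standard axioms; NO named fact — the only definition is the predicate `FullBSDOffSs3Prime`): the
nesting `FullBSDOffSs3Prime → FullBSDOffSsPrime`, the transfer theorem at every `c`, and its instance at
`c⁰ = 17190625/104166656`.

## References

* C. Skinner, Pacific J. Math. 283 (2016) 171–200, Thm. C (p. 173: "a prime `p ≥ 3`").
  [cite: Skinner2016PacificMC, Thm. C]
* M. Bhargava, C. Skinner, W. Zhang, arXiv:1407.1826 (2014), Cor. 22 (p. 10). [cite: BhargavaSkinnerZhang2014, Cor. 22]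
* W. Duke, C. R. Acad. Sci. Paris 325 (1997) 813–818, Thm. 1. [cite: Duke1997, Thm. 1 (p. 815)]
* R. L. Miller, LMS J. Comput. Math. 14 (2011), Def. 1.1 (`BSDp`). [cite: Miller2011LMS, Def. 1.1]
-/

noncomputable section

open scoped Classical
open WeierstrassCurve Filter Topology Literature.NumberTheory.EllipticCurves

namespace Literature.NumberTheory.EllipticCurves

/-- **The full BSD formula off `S_ss³(E) = {2} ∪ {additive p} ∪ {good supersingular p}`** for the curve
`E_{A,B}`: for every globally minimal model `W = C • E_{A,B}` and every prime `p ≥ 3` at which `W` has good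
ordinary reduction (`Rank1Residual.GoodOrd`) OR multiplicative reduction, Miller's `BSD(E,p)` holds
(`BSDp W p`). The `p ≥ 3` form of `FullBSDOffSsPrime` (row (ii-3a), which asks `p ≥ 5`); no exceptional set.
[cite: Miller2011LMS, Def. 1.1 (arXiv:1010.2431 p. 3)] -/
def FullBSDOffSs3Prime (AB : ℤ × ℤ) : Prop :=
  ∀ (W : WeierstrassCurve ℚ) [W.IsElliptic] [W.IsGloballyMinimal] (C : VariableChange ℚ),
    C • shortWeierstrass AB = W → ∀ (p : ℕ) [Fact p.Prime], 3 ≤ p →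
      (Rank1Residual.GoodOrd W p ∨ W.HasMultiplicativeReductionAtPrime p) → BSDp W p

/-- `S_ss³(E) ⊆ S_ss(E)`: the `p ≥ 3` statement implies row (ii-3a)'s `p ≥ 5` statement `FullBSDOffSsPrime`.
[cite: Miller2011LMS, Def. 1.1 (arXiv:1010.2431 p. 3)] -/
theorem FullBSDOffSs3Prime.fullBSDOffSsPrime {AB : ℤ × ℤ} (h : FullBSDOffSs3Prime AB) :
    FullBSDOffSsPrime AB :=
  fun W _ _ C hW p _ hp hred ↦ h W C hW p (le_trans (by norm_num) hp) hred

/-- **Full BSD off `S_ss³(E)` for at least the analytic-rank-`0` proportion of curves** (row (ii-3a) of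
`PERCENT-FULL.md` at the vendored range `p ≥ 3`; (F1) and (F3) discharged). If a proportion `≥ c` of the curves
`E_{A,B}/ℚ`, ordered by naive height, have `ord_{s=1} L(E,s) = 0`, then — given Duke 1997 Thm. 1, Skinner 2016
Thm. C (printed for `p ≥ 3`), modularity and Gross–Zagier–Kolyvagin — a proportion `≥ c` have analytic rank `0`,
satisfy the rank part of BSD, AND satisfy `BSD(E,p)` at EVERY prime `p ≥ 3` of good ordinary or multiplicative
reduction. Same proof as `HeightDensityGE.analyticRankZero_and_fullBSDOffSsPrime_of_sieve` with `3 ≤ p` fed to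
the glue `bsdp_rankZero_of_Skinner2016` directly: the auxiliary multiplicative prime is one of the two exact
primes `ℓᵢ ≥ 5` of (F3), `≠ p`, with `v_{ℓᵢ}(Δ_min) = 1` by (T), hence `p ∤ v_{ℓᵢ}(Δ_min)` for every prime `p`.
[cite: Skinner2016PacificMC, Thm. C (p. 173)] [cite: BhargavaSkinnerZhang2014, Cor. 22 and Lemma 20 (proof)]
[cite: Duke1997, Thm. 1 (p. 815)] -/
theorem HeightDensityGE.analyticRankZero_and_fullBSDOffSs3Prime_of_sieve
    (hD : Duke1997_exceptionalPrimes_densityZero) (hSk : Skinner2016_padicValRat_bsd_rank_zero)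
    (hmod : hasEntireLFunction_rat) (hGZK : rank_eq_analyticRank_of_analyticRank_le_one)
    {c : ℝ} (hA0 : HeightDensityGE AnalyticRankZero c) :
    HeightDensityGE
      (fun AB ↦ AnalyticRankZero AB ∧ SatisfiesBSDRankLeOne AB ∧ FullBSDOffSs3Prime AB) c := by
  have h3 := (hA0.and_of_one (heightDensityGE_forall_surj_of_duke hD)).and_of_one
    heightDensityGE_twoOrdOnePrimes_one
  refine BhargavaSkinnerZhang2014.HeightDensityGE.mono ?_ h3
  rintro AB ⟨⟨⟨hfam, hr0⟩, hS⟩, hM⟩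
  haveI := isElliptic_shortWeierstrass hfam
  -- the rank part in analytic rank `0`, from Gross–Zagier–Kolyvagin
  have hGZ := hGZK (shortWeierstrass AB) (by omega)
  refine ⟨⟨hfam, hr0⟩, ⟨hfam, hGZ.1, by omega, hGZ.2⟩, ?_⟩
  intro W _ _ C hW p _ hp hred
  have hpP : p.Prime := Fact.out
  -- analytic rank of the minimal model `W = C • E_{A,B}`
  have hr : W.analyticRank = 0 := by
    have e : (C • shortWeierstrass AB).analyticRank = (shortWeierstrass AB).analyticRank :=
      analyticRank_variableChange_holds (shortWeierstrass AB) C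
    rw [← hW, e, hr0]
  -- irreducibility from surjectivity (F1), at every prime `p`
  have hirr : W.HasIrreducibleModPGaloisRep p :=
    hasIrreducibleModPGaloisRep_of_hasSurjectiveModNGaloisRep W p (hS W C hW p)
  -- two distinct multiplicative primes with `v_ℓ(Δ_min) = 1`, from (F3) and (T); one of them is `≠ p`
  obtain ⟨ℓ₁, ℓ₂, hℓ₁, hℓ₂, h5₁, h5₂, hne, hv₁, hv₂⟩ := hM
  haveI i₁ : Fact ℓ₁.Prime := ⟨hℓ₁⟩
  haveI i₂ : Fact ℓ₂.Prime := ⟨hℓ₂⟩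
  have hm₁ : W.HasMultiplicativeReductionAtPrime ℓ₁ :=
    hW ▸ hasMultiplicativeReductionAtPrime_smul_shortWeierstrass_of_padicValInt_eq_one hfam C h5₁ hv₁
  have hm₂ : W.HasMultiplicativeReductionAtPrime ℓ₂ :=
    hW ▸ hasMultiplicativeReductionAtPrime_smul_shortWeierstrass_of_padicValInt_eq_one hfam C h5₂ hv₂
  have hw₁ : ¬ p ∣ padicValInt ℓ₁ W.minimalDiscriminantInt := by
    rw [padicValInt_minimalDiscriminantInt_smul_shortWeierstrass hfam W C hW h5₁, hv₁]
    exact hpP.not_dvd_one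
  have hw₂ : ¬ p ∣ padicValInt ℓ₂ W.minimalDiscriminantInt := by
    rw [padicValInt_minimalDiscriminantInt_smul_shortWeierstrass hfam W C hW h5₂, hv₂]
    exact hpP.not_dvd_one
  have hram : ∃ q : ℕ, ∃ _ : Fact q.Prime, q ≠ p ∧ W.HasMultiplicativeReductionAtPrime q ∧
      ¬ p ∣ padicValInt q W.minimalDiscriminantInt := by
    by_cases h : ℓ₁ = p
    · exact ⟨ℓ₂, i₂, fun h' ↦ hne (h.trans h'.symm), hm₂, hw₂⟩
    · exact ⟨ℓ₁, i₁, h, hm₁, hw₁⟩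
  exact bsdp_rankZero_of_Skinner2016 hSk hmod hGZK W p hp hred hirr hram hr

/-- **Row (ii-3a) at `p ≥ 3` and `c⁰ = 17190625 / 104166656 = 0.165030…`**: IF a proportion `≥ c⁰` of the
curves `E_{A,B}` has analytic rank `0` (Bhargava–Skinner–Zhang Cor. 22's printed `.16503` times the cell's family
normaliser; a hypothesis here), then a proportion `≥ c⁰` has analytic rank `0`, satisfies the rank part of BSD,
and satisfies `BSD(E,p)` at every prime `p ≥ 3` of good ordinary or multiplicative reduction.
[cite: BhargavaSkinnerZhang2014, Cor. 22 (p. 10)] [cite: Skinner2016PacificMC, Thm. C (p. 173)] -/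
theorem heightDensityGE_analyticRankZero_and_fullBSDOffSs3Prime_c0_of_sieve
    (hA0 : HeightDensityGE AnalyticRankZero (17190625 / 104166656))
    (hD : Duke1997_exceptionalPrimes_densityZero) (hSk : Skinner2016_padicValRat_bsd_rank_zero)
    (hmod : hasEntireLFunction_rat) (hGZK : rank_eq_analyticRank_of_analyticRank_le_one) :
    HeightDensityGE
      (fun AB ↦ AnalyticRankZero AB ∧ SatisfiesBSDRankLeOne AB ∧ FullBSDOffSs3Prime AB)
      (17190625 / 104166656) :=
  HeightDensityGE.analyticRankZero_and_fullBSDOffSs3Prime_of_sieve hD hSk hmod hGZK hA0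

/-- The `p ≥ 3` row implies row (ii-3a) as certified (`FullBSDOffSsPrime`, `p ≥ 5`) for the same proportion.
[cite: BhargavaSkinnerZhang2014, Cor. 22 (p. 10)] -/
theorem HeightDensityGE.analyticRankZero_and_fullBSDOffSsPrime_of_fullBSDOffSs3Prime
    {c : ℝ} (h : HeightDensityGE
      (fun AB ↦ AnalyticRankZero AB ∧ SatisfiesBSDRankLeOne AB ∧ FullBSDOffSs3Prime AB) c) :
    HeightDensityGE
      (fun AB ↦ AnalyticRankZero AB ∧ SatisfiesBSDRankLeOne AB ∧ FullBSDOffSsPrime AB) c := by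
  refine BhargavaSkinnerZhang2014.HeightDensityGE.mono ?_ h
  rintro AB ⟨h0, hR, hS⟩
  exact ⟨h0, hR, hS.fullBSDOffSsPrime⟩

end Literature.NumberTheory.EllipticCurves

end
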